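import Literature.AlgebraicGeometry.Morphisms.ProjectiveOverBaseOfFibres
import Literature.AlgebraicGeometry.Morphisms.ProjectiveOfFibreEmbedding
import HarnessLib

/-!
# Restricted global sections spanning the embedding sections of a fibre embed it; hence projective over any base

Topic `AlgebraicGeometry/Morphisms`; namespace `Literature.AlgebraicGeometry.Morphisms`. THEOREMS ONLY (no definition, no named
fact, no instance, no `sorry`).

The SPAN FORM of the fibre step of EGA III 4.7.1, with no flatness, noetherian, `H¹` or universe hypothesis: let `iX : X₀ → X`
be any morphism (a fibre), `f₀ : X₀ → Spec k` universally closed (`k` any commutative ring), `E` an `𝒪_X`-module with a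
rank-one frame system `F`, `b₀,…,b_m ∈ Γ(X, E)` global sections and `s₀,…,sₙ ∈ Γ(X₀, iX^*E)` sections OF THE FIBRE which
generate `iX^*E` and embed `X₀ ↪ ℙⁿ_k`. If every `sᵢ` lies in the `Γ(Spec k, 𝒪)`-span of the restricted sections `η(b_j)`
(e.g. because `π_*E` commutes with base change at this fibre — cohomology and base change; or ★ G5
`span_unitSectionLE_top_eq_top_at_prime` under `Ext¹ = 0`, which is how ★ `Morphisms/ProjectiveOfFibresEmbedding` §1 obtains
it), then

* `isClosedImmersion_toProj_comap_of_span` — the `b_j` generate `E` along `iX` and their restrictions embed `X₀ ↪ ℙ^m_k`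
  (in the pulled-back-datum form `(ofFrameSystem F h1 b).comap iX` consumed by ★ `Morphisms/ProjectiveOverBaseOfFibres`);

and over ANY base scheme `T`, for `f : X → T` proper:

* `iSup_basicOpen_coeffAt_eq_top_of_fibres_span`, **`isProjective_of_fibres_span`** — if every `t ∈ T` has a fibre presentation
  (ANY cartesian square over some `Spec K → T` through which `Spec κ(t)` factors) with embedding sections `s` in the span of
  the restricted `b_j`, then the `b_j` generate `E` and `f` is PROJECTIVE (★ `isProjective_of_generatingSections_fin_of_isPullback`).

Road: ★ `isClosedImmersion_toProj_of_linear` (brick 1: the `s` embed and are combinations of the `η(b)` ⇒ the `η(b)` embed),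
★ `ofCocycleSections_ofFrameSystem_pullback` / `coeffAt_pullback` (brick 2 §2), ★ `ofCocycleSections_comap`. Cell `hodgecm-mathlib`,
F-DAG (h2)/F-6 capital (B-p20 (g11)); count-neutral (HC_CM is proved only modulo the 7 printed citations until rung 0 closes).

## References
* A. Grothendieck, J. Dieudonné, *EGA III₁* (Publ. Math. IHÉS 11, 1961), Thm. 4.7.1. [EGAIII1]
* R. Hartshorne, *Algebraic Geometry* (1977), II Thm. 7.1, II Prop. 7.2; II §4 Definition p.103 (projective morphism). [Hartshorne1977]
-/

noncomputable section

-- `TopCat.Presheaf`/`Scheme.Modules` and pull-back bookkeeping (as in ★ `Morphisms/ProjectiveOfFibreEmbedding`).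
set_option backward.isDefEq.respectTransparency false

universe u

open CategoryTheory CategoryTheory.Limits AlgebraicGeometry TopologicalSpace Opposite
open Literature.AlgebraicGeometry.Modules
open Literature.AlgebraicGeometry.Motives Literature.AlgebraicGeometry.Motives.GeneratingSections
open Literature.AlgebraicGeometry.Motives.Segre

namespace Literature.AlgebraicGeometry.Morphisms

attribute [local instance] MvPolynomial.gradedAlgebra

/-! ## §0 Bookkeeping -/

/-- Two-step restriction of `𝒪_X` equals the one-step restriction with the same ends. [folklore] -/
private theorem span_map_map_eq (Y : Scheme.{u}) {A B B' : Y.Opens} (p : op A ⟶ op B) (q : op B ⟶ op B')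
    (r : op A ⟶ op B') (x : Γ(Y, A)) : Y.presheaf.map q (Y.presheaf.map p x) = Y.presheaf.map r x := by
  rw [← CommRingCat.comp_apply, ← Functor.map_comp]
  have : p ≫ q = r := congrArg Quiver.Hom.op (Subsingleton.elim (p ≫ q).unop r.unop)
  rw [this]

/-- In a cartesian square `fst ≫ f = snd ≫ g`, a point `x` with `f x = g y` is `fst` of some point. [folklore] -/
private theorem span_exists_fst_eq {P X' Y Z : Scheme.{u}} {fst : P ⟶ X'} {snd : P ⟶ Y} {f : X' ⟶ Z}
    {g : Y ⟶ Z} (h : IsPullback fst snd f g) (x : X') (y : Y) (hxy : f x = g y) : ∃ p : P, x = fst p := by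
  haveI : HasPullback f g := h.hasPullback
  obtain ⟨z, hz, -⟩ := Scheme.Pullback.exists_preimage_pullback x y hxy
  refine ⟨h.isoPullback.inv z, ?_⟩
  rw [← Scheme.Hom.comp_apply, IsPullback.isoPullback_inv_fst, hz]

/-- Membership in the span of a finite family, as an explicit combination. [folklore] -/
private theorem span_exists_fun_of_mem {R M : Type*} [Semiring R] [AddCommMonoid M] [Module R M] {α : Type*}
    [Fintype α] {v : α → M} {x : M} (hx : x ∈ Submodule.span R (Set.range v)) : ∃ c : α → R, ∑ i, c i • v i = x := by
  obtain ⟨c, hc⟩ := Finsupp.mem_span_range_iff_exists_finsupp.mp hx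
  exact ⟨c, by rw [← hc, Finsupp.sum_fintype c (fun i a ↦ a • v i) (fun i ↦ zero_smul _ _)]⟩

/-! ## §1 One fibre: the span form of the fibre step -/

section Fibre

variable {k : Type u} [CommRing k] {X X₀ : Scheme.{u}} (iX : X₀ ⟶ X) (f₀ : X₀ ⟶ Spec (.of k)) [UniversallyClosed f₀]
  {E : X.Modules} (F : FrameSystem E) (h1 : ∀ x, F.rank x = 1) (h1₀ : ∀ x, (F.pullback iX).rank x = 1) {n m : ℕ}
  (s : Fin (n + 1) → Γ((Scheme.Modules.pullback iX).obj E, ⊤))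
  (hcov : ⨆ i, ⨆ x, X₀.basicOpen ((CocycleSections.ofFrameSystem (F.pullback iX) h1₀ s).coeff i x) = ⊤)
  (H : IsClosedImmersion ((ofCocycleSections (F.pullback iX).U
    (CocycleSections.ofFrameSystem (F.pullback iX) h1₀ s) hcov).toProj f₀))
  (b : Fin (m + 1) → Γ(E, ⊤))
  (hs : ∀ i, SecMod.mk (L := (Scheme.Modules.pullback iX).obj E) (ρ := f₀.appTop.hom) (U := ⊤) (s i) ∈
    Submodule.span Γ(Spec (.of k), ⊤) (Set.range fun j ↦
      SecMod.mk (L := (Scheme.Modules.pullback iX).obj E) (ρ := f₀.appTop.hom) (U := ⊤)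
        (unitSectionLE iX E (V := ⊤) (U := ⊤) le_top (b j))))

include H hs

/-- **Span form of the fibre step of EGA III 4.7.1**: `f₀ : X₀ → Spec k` universally closed, `iX : X₀ → X`, fibre sections
`s` generating `iX^*E` and embedding `X₀ ↪ ℙⁿ_k`; if each `sᵢ` is a `Γ(Spec k, 𝒪)`-combination of the restrictions `η(b_j)` of
global sections `b₀,…,b_m ∈ Γ(X, E)`, then the `b_j` generate `E` along `iX` and their restrictions embed `X₀ ↪ ℙ^m_k`
(pulled-back datum ★ `(ofFrameSystem F h1 b).comap iX`). ★ `isClosedImmersion_toProj_of_linear` on the joint datum `(s, η ∘ b)`.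
[cite: EGAIII1, Thm. 4.7.1] [cite: Hartshorne1977, II Prop. 7.2] -/
theorem isClosedImmersion_toProj_comap_of_span :
    (∀ y : X₀, ∃ j, iX y ∈ X.basicOpen (coeffAt F h1 b j (iX y))) ∧
      ∃ hcov₀ : ⨆ j, ⨆ a, X₀.basicOpen (((CocycleSections.ofFrameSystem F h1 b).comap iX).coeff j a) = ⊤,
        IsClosedImmersion
          ((ofCocycleSections (fun a => iX ⁻¹ᵁ F.U a) ((CocycleSections.ofFrameSystem F h1 b).comap iX) hcov₀).toProj f₀) := by
  classical
  let E₀ : X₀.Modules := (Scheme.Modules.pullback iX).obj E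
  let F₀ : FrameSystem E₀ := F.pullback iX
  let η : Γ(E, ⊤) → Γ(E₀, ⊤) := fun u ↦ unitSectionLE iX E (V := ⊤) (U := ⊤) le_top u
  -- Step 1: each `s i` is a combination of the `η(b_j)` with coefficients in `Γ(Spec k, 𝒪)`
  have hc : ∀ i, ∃ c : Fin (m + 1) → Γ(Spec (.of k), ⊤),
      ∑ j, c j • SecMod.mk (L := E₀) (ρ := f₀.appTop.hom) (U := ⊤) (η (b j)) =
        SecMod.mk (L := E₀) (ρ := f₀.appTop.hom) (U := ⊤) (s i) := fun i ↦ span_exists_fun_of_mem (hs i)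
  choose c hc using hc
  have hrel : ∀ i, s i = ∑ j, toSections f₀.appTop.hom ⊤ (c i j) • η (b j) := fun i ↦ by
    have h := congrArg (SecMod.val (L := E₀) (ρ := f₀.appTop.hom)) (hc i)
    rw [SecMod.val_mk] at h
    rw [← h]
    induction (Finset.univ : Finset (Fin (m + 1))) using Finset.induction_on with
    | empty => rfl
    | insert j T hj ih => rw [Finset.sum_insert hj, Finset.sum_insert hj, SecMod.val_add, ih]; rfl
  -- Step 2: the joint datum `(s, η ∘ b)` in the pulled-back frames and its linear relation over `k`
  let u : Fin (n + 1) ⊕ Fin (m + 1) → Γ(E₀, ⊤) := Sum.elim s (fun j ↦ η (b j))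
  let S : CocycleSections (Fin (n + 1) ⊕ Fin (m + 1)) F₀.U := CocycleSections.ofFrameSystem F₀ h1₀ u
  let cc : Fin (n + 1) → Fin (m + 1) → k := fun i j ↦ (Scheme.ΓSpecIso (.of k)).hom (c i j)
  have hpull : ∀ i j, pull f₀ (cc i j) = f₀.appTop (c i j) := fun i j ↦ by
    rw [pull_apply]
    change f₀.appTop (((Scheme.ΓSpecIso (.of k)).hom ≫ (Scheme.ΓSpecIso (.of k)).inv) (c i j)) = _
    rw [Iso.hom_inv_id]
    rfl
  have hlin : ∀ i x, S.coeff (.inl i) x =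
      ∑ j, X₀.presheaf.map (homOfLE (le_top : F₀.U x ≤ ⊤)).op (pull f₀ (cc i j)) * S.coeff (.inr j) x := by
    intro i x
    change coeffAt F₀ h1₀ u (.inl i) x = ∑ j, _ * coeffAt F₀ h1₀ u (.inr j) x
    have hu : u (.inl i) = ∑ j ∈ Finset.univ, toSections f₀.appTop.hom ⊤ (c i j) • u (.inr j) := hrel i
    rw [coeffAt_sum_smul F₀ h1₀ Finset.univ (fun j ↦ toSections f₀.appTop.hom ⊤ (c i j)) (fun j ↦ u (.inr j)) u
      (.inl i) hu x]
    refine Finset.sum_congr rfl fun j _ ↦ ?_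
    congr 1
    rw [hpull, toSections, RingHom.comp_apply]
    exact span_map_map_eq X₀ _ _ _ _
  -- the two sub-families
  have hinl : S.restrict Sum.inl = CocycleSections.ofFrameSystem F₀ h1₀ s := CocycleSections.ext rfl
  have hinr : S.restrict Sum.inr = CocycleSections.ofFrameSystem F₀ h1₀ (fun j ↦ η (b j)) := CocycleSections.ext rfl
  have hcov_inl : ⨆ i, ⨆ x, X₀.basicOpen ((S.restrict Sum.inl).coeff i x) = ⊤ := by rw [hinl]; exact hcov
  have hcov_inr : ⨆ j, ⨆ x, X₀.basicOpen ((S.restrict Sum.inr).coeff j x) = ⊤ :=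
    iSup_basicOpen_inr_eq_top_of_linear f₀ S cc hlin hcov_inl
  have H' : IsClosedImmersion ((ofCocycleSections F₀.U (S.restrict Sum.inl) hcov_inl).toProj f₀) := by
    have e : ofCocycleSections F₀.U (S.restrict Sum.inl) hcov_inl =
        ofCocycleSections F₀.U (CocycleSections.ofFrameSystem F₀ h1₀ s) hcov := by
      congr 1
    rw [e]
    exact H
  -- Step 3 (brick 1): the restricted global sections `η(b_j)` embed the fibre
  have Ht : IsClosedImmersion ((ofCocycleSections F₀.U (S.restrict Sum.inr) hcov_inr).toProj f₀) :=
    isClosedImmersion_toProj_of_linear f₀ S cc hlin hcov_inl hcov_inr H'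
  have hcov_t : ⨆ j, ⨆ x, X₀.basicOpen ((CocycleSections.ofFrameSystem F₀ h1₀ (fun j ↦ η (b j))).coeff j x) = ⊤ := by
    rw [← hinr]; exact hcov_inr
  have Ht' : IsClosedImmersion ((ofCocycleSections F₀.U
      (CocycleSections.ofFrameSystem F₀ h1₀ (fun j ↦ η (b j))) hcov_t).toProj f₀) := by
    have e : ofCocycleSections F₀.U (CocycleSections.ofFrameSystem F₀ h1₀ (fun j ↦ η (b j))) hcov_t =
        ofCocycleSections F₀.U (S.restrict Sum.inr) hcov_inr := by
      congr 1
    rw [e]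
    exact Ht
  -- Step 4 (brick 2 §2): translate to the pulled-back datum of `b`
  have hcov₀ := iSup_basicOpen_comap_coeff_eq_top_of_pullback iX F h1 b h1₀ hcov_t
  refine ⟨fun y ↦ ?_, hcov₀, ?_⟩
  · have hy : y ∈ (⊤ : X₀.Opens) := trivial
    rw [← hcov_t, Opens.mem_iSup] at hy
    obtain ⟨j, hj⟩ := hy
    rw [CocycleSections.ofFrameSystem_coeff, mem_iSup_basicOpen_coeffAt_iff] at hj
    exact ⟨j, mem_basicOpen_coeffAt_of_pullback iX F h1 b h1₀ j y hj⟩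
  · rw [← ofCocycleSections_ofFrameSystem_pullback iX F h1 b h1₀ hcov_t hcov₀]
    exact Ht'

end Fibre

/-! ## §2 Over any base scheme -/

section General

variable {X T : Scheme.{u}} (f : X ⟶ T) [IsProper f] {E : X.Modules} (F : FrameSystem E) (h1 : ∀ x, F.rank x = 1)
  {m : ℕ} (b : Fin (m + 1) → Γ(E, ⊤))
  (H : ∀ t : T, ∃ (K : Type u) (_ : CommRing K) (iK : Spec (.of K) ⟶ T) (σ : Spec (T.residueField t) ⟶ Spec (.of K))
    (_ : σ ≫ iK = T.fromSpecResidueField t) (X₀ : Scheme.{u}) (iX : X₀ ⟶ X) (f₀ : X₀ ⟶ Spec (.of K))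
    (_ : IsPullback iX f₀ f iK) (h1₀ : ∀ x, (F.pullback iX).rank x = 1) (n : ℕ)
    (s : Fin (n + 1) → Γ((Scheme.Modules.pullback iX).obj E, ⊤))
    (hcov : ⨆ i, ⨆ x, X₀.basicOpen ((CocycleSections.ofFrameSystem (F.pullback iX) h1₀ s).coeff i x) = ⊤)
    (_ : IsClosedImmersion ((ofCocycleSections (F.pullback iX).U
      (CocycleSections.ofFrameSystem (F.pullback iX) h1₀ s) hcov).toProj f₀)),
    ∀ i, SecMod.mk (L := (Scheme.Modules.pullback iX).obj E) (ρ := f₀.appTop.hom) (U := ⊤) (s i) ∈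
      Submodule.span Γ(Spec (.of K), ⊤) (Set.range fun j ↦
        SecMod.mk (L := (Scheme.Modules.pullback iX).obj E) (ρ := f₀.appTop.hom) (U := ⊤)
          (unitSectionLE iX E (V := ⊤) (U := ⊤) le_top (b j))))

include h1 H

/-- **The global sections generate everywhere** (every point of `X` lies on a presented fibre, where §1 applies).
[cite: EGAIII1, Thm. 4.7.1] -/
theorem iSup_basicOpen_coeffAt_eq_top_of_fibres_span :
    ⨆ j, ⨆ x, X.basicOpen (coeffAt F h1 b j x) = ⊤ := by
  refine (iSup_basicOpen_coeffAt_eq_top_iff F h1 b).mpr fun x ↦ ?_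
  obtain ⟨K, _, iK, σ, hσ, X₀, iX, f₀, HX, h1₀, n, s, hcov, Hemb, hs⟩ := H (f x)
  haveI : IsProper f₀ := MorphismProperty.of_isPullback HX inferInstance
  -- `x = iX y`: `f x = iK (σ ⊥)`
  have hfx : f x = iK (σ (⊥ : PrimeSpectrum (T.residueField (f x)))) := by
    conv_lhs => rw [← Scheme.fromSpecResidueField_apply (f x) (⊥ : PrimeSpectrum (T.residueField (f x))), ← hσ]
    rw [Scheme.Hom.comp_apply]
  obtain ⟨y, rfl⟩ := span_exists_fst_eq HX x _ hfx
  obtain ⟨hgen, -⟩ := isClosedImmersion_toProj_comap_of_span iX f₀ F h1 h1₀ s hcov Hemb b hs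
  exact hgen y

/-- **EGA III 4.7.1 over any base, span form ⇒ PROJECTIVE.** `f : X → T` proper, `F` a rank-one frame system of `E`,
`b₀,…,b_m ∈ Γ(X, E)`; if every `t ∈ T` has a fibre presentation `X₀ = X ×_T Spec K` (any cartesian square over some
`Spec K → T` through which `Spec κ(t)` factors) with sections `s` of `iX^*E` generating it and embedding `X₀ ↪ ℙⁿ_K`, each `sᵢ` in
the span of the restricted `b_j`, then the `b_j` embed `X ↪ 𝐏^m_T`: `f` is projective (★ `isProjective_of_generatingSections_fin_of_isPullback`).
[cite: EGAIII1, Thm. 4.7.1] [cite: Hartshorne1977, II §4 Definition p.103 (projective morphism)] -/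
theorem isProjective_of_fibres_span : Literature.AlgebraicGeometry.Morphisms.IsProjective f := by
  have hcovb : ⨆ j, ⨆ x : X, X.basicOpen ((CocycleSections.ofFrameSystem F h1 b).coeff j x) = ⊤ :=
    iSup_basicOpen_coeffAt_eq_top_of_fibres_span f F h1 b H
  refine isProjective_of_generatingSections_fin_of_isPullback f
    (ofCocycleSections F.U (CocycleSections.ofFrameSystem F h1 b) hcovb) fun t ↦ ?_
  obtain ⟨K, _, iK, σ, hσ, X₀, iX, f₀, HX, h1₀, n, s, hcov, Hemb, hs⟩ := H t
  haveI : IsProper f₀ := MorphismProperty.of_isPullback HX inferInstance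
  obtain ⟨-, hcov₀, H₀⟩ := isClosedImmersion_toProj_comap_of_span iX f₀ F h1 h1₀ s hcov Hemb b hs
  refine ⟨K, inferInstance, iK, σ, hσ, X₀, iX, f₀, HX, ?_⟩
  rw [← ofCocycleSections_comap iX (CocycleSections.ofFrameSystem F h1 b) hcovb]
  have e : ofCocycleSections (fun a => iX ⁻¹ᵁ F.U a) ((CocycleSections.ofFrameSystem F h1 b).comap iX)
      (CocycleSections.iSup_basicOpen_comap_coeff iX _ hcovb) =
      ofCocycleSections (fun a => iX ⁻¹ᵁ F.U a) ((CocycleSections.ofFrameSystem F h1 b).comap iX) hcov₀ := rfl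
  rw [e]
  exact H₀

end General

end Literature.AlgebraicGeometry.Morphisms
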